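import Summits.AtomisticToContinuum.Crystallization.Theorems.FrustratedLawDichotomyAtlasReachF1Sharp
import Summits.AtomisticToContinuum.Crystallization.Theorems.FrustratedLawDichotomyAperiodicFrustratedLawGapErgodicStub

/-!
# FrustratedLawDichotomy · crux `AperiodicFrustratedLawGap` (stmt-AtomisticToContinuum-27623) — THE MASS REGIMES REDUCE TO ERGODIC LAWS
# (decomp-a2c hand-2 g51, STRUCTURAL share of the registered residual `stub_aperiodicErgodicGap`: «most general landed lemma first, then specialise»)

The registered residual `stub_aperiodicErgodicGap` (`S_aperiodicErgodicGap`) carries an ERGODICITY clause (every measurable re-rooting-invariant set of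
configurations is trivial), and the tree's ergodic cut `…ErgodicCut.aperiodicFrustratedLawGap_iff_ergodicCase` shows the crux is equivalent to it.  The
atlas programme, however, attacks the crux through the MASS SPLIT of (404) `…AtlasReach`: F(η) `CoherentMassExclusion n K η` (no admissible minimising
law puts mass `< η` off the rows — PROVED at the certified reach, (407)/F1Sharp) and the residual of record A(η) `OffAtlasMassGap n K η` (no admissible
minimising law puts mass `≥ η` off the rows), both instances of `NoAdmissibleMinimiserWith X` — whose binder list has NO ergodicity clause.  This file
puts the clause back, for every regime that a mixture can not hide:

* §1 (pure measure theory, the general lemma) **half-line regimes are DETECTED by kernel mixtures.**  For a probability measure `Q`, a measurable kernel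
  `F` and `P = Q.bind F`: `c ≤ ∫⁻ g dP` (finite) forces `c ≤ ∫⁻ g d(F ω)` for a NON-NULL set of indices `ω` (`frequently_le_lintegral_of_bind`, Markov /
  strict monotonicity of the integral), and `∫⁻ g dP < c` forces `∫⁻ g d(F ω) < c` frequently (`frequently_lintegral_lt_of_bind`); specialised to the
  mass of one measurable set in `ℝ≥0∞` and in `ℝ` (`frequently_le_measure_of_bind`, `frequently_measure_lt_of_bind`, `frequently_le_measureReal_of_bind`,
  `frequently_measureReal_lt_of_bind`).
* §2 **the transfer along a kernel decomposition, almost-everywhere form** (`ae_admissible_of_bind`): the tree's `…ErgodicTransfer.exists_of_bind`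
  concluded that SOME component inherits the almost-sure clauses, the null periodic event and `E[rootEnergy] ≤ e⋆`; the same argument gives it for
  `Q`-ALMOST EVERY component (the energy floor of item 9229 is used through its PROVED form `unimodularEnergyLowerBound_proof`, so nothing here is
  conditional).  An almost-everywhere statement can be intersected with a «frequently» statement — this is the whole point.
* §3 ★★ **`noAdmissibleMinimiserWith_of_ergodic`**: for every regime `X` detected by kernel mixtures (hypothesis `hdet`, discharged by §1 for half-line
  regimes), `NoAdmissibleMinimiserWith X` follows from its ERGODIC RESTRICTION `NoAdmissibleMinimiserWith (X ∧ ergodic)` — decompose an admissible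
  minimising law in the regime by the tree's PROVED kernel ergodic decomposition (`…ErgodicAssembly.kernelDecomposition_of_aeErgodic` with step D5
  `…ErgodicAeErgodic.aeErgodic_condExpKernel_hErg`), and pick a component that is admissible, minimising, ergodic (§2, a.e.) AND in the regime (hdet,
  frequently).
* §4 specialisations BY NAME: `offAtlasMassGap_of_ergodic` (A(η) ⟸ its ergodic restriction), `coherentMassExclusion_of_ergodic` (F(η) likewise),
  `noAdmissibleMinimiser_of_ergodic` (`X = True`: the ergodic cut as the degenerate instance), the junction `aperiodicFrustratedLawGap_of_massSplit_ergodic`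
  (F(η) + ergodic A(η) ⟹ crux) and the RESIDUAL OF RECORD made ergodic: `aperiodicFrustratedLawGap_of_ergodicOffAtlasMassGap_F1_sharp` — the crux ⟸ «no
  ERGODIC admissible minimising law puts mass `≥ reach (23/10⁴) 5` off the certified F1 row» (F1Sharp's unconditional F side, by name).

HONEST LABELS.  Bookkeeping / junction only: nothing here prices a configuration, and A(η) restricted to ergodic laws is still the whole difficulty of
the crux (TetrahedralFrustration / IcosahedralClusters).  What is gained is one hypothesis for the next cut, for free: whoever attacks the residual of
record may assume the law ERGODIC, so that «mass `≥ η` off the atlas» is a statement about ONE law all of whose invariant events are trivial (the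
frequency reading of `P(U)` is then available to spatial arguments), exactly as the registered stub `stub_aperiodicErgodicGap` already grants for the
un-split crux.  DEF-FREE (theorems only); imports TREE `…AtlasReachF1Sharp` (hence (404) `…AtlasReach`) and `…ErgodicStub` (hence the ergodic
decomposition files) only; no instance / notation / option; 0 sorry.  Tags: §1–§2 [folklore: measure theory / ergodic decomposition], §3–§4 [new: junction].
-/

noncomputable section

namespace Summit.AtomisticToContinuum.Crystallization.Theorems.FrustratedLawDichotomyAtlasReachErgodic

open MeasureTheory Set Filter
open scoped ENNReal BigOperators
open Literature.MathematicalPhysics.StatisticalMechanics (lennardJones rootEnergy PeriodicConfiguration)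
open Literature.Probability.Process (IsRootedHardCore IsPointStationaryLaw)
open Literature.Probability.Process.LocalConfig (RootedHardCoreConfig)
open Summit.AtomisticToContinuum.Crystallization.Theorems.ChargedEnergyGapNegative (E3)
open Summit.AtomisticToContinuum.Crystallization.Theorems.FrustratedLawDichotomyAtlasReach
  (reach NoAdmissibleMinimiserWith CoherentMassExclusion OffAtlasMassGap noAdmissibleMinimiserWith_mono noAdmissibleMinimiserWith_split
    aperiodicFrustratedLawGap_of_noAdmissibleMinimiser)
open Summit.AtomisticToContinuum.Crystallization.Theorems.FrustratedLawDichotomyAtlasReachF1Sharp (coherentMassExclusion_F1_sharp)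
open Summit.AtomisticToContinuum.Crystallization.Theorems.FrustratedLawDichotomyCellF1cRow (KF1c measurableSet_KF1c)
open Summit.AtomisticToContinuum.Crystallization.Theorems.FrustratedLawDichotomyErgodicReduction
  (ae_ae_of_ae_bind exists_measurable_bounded_rootEnergy integral_eq_toReal_lintegral_sub lintegral_ofReal_add_le
    kernelDecomposition_of_aeErgodic aeErgodic_condExpKernel_hErg)

/-! ## §1. Half-line regimes are detected by kernel mixtures (pure measure theory) -/

section Detect

variable {Ω α : Type*} [MeasurableSpace Ω] [MeasurableSpace α] {Q : Measure Ω} {F : Ω → Measure α}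

/-- ★ **LOWER HALF-LINES ARE DETECTED.**  If `P = Q.bind F` (a probability mixture of the measures `F ω` by a measurable kernel) gives a measurable
`g ≥ 0` a FINITE integral `≥ c`, then `∫⁻ g d(F ω) ≥ c` for a non-null set of indices `ω`: otherwise `∫⁻ g d(F ω) < c` almost everywhere and the
strict monotonicity of the integral (`lintegral_strict_mono`, a probability measure is non-zero) gives `∫⁻ g dP = ∫ (∫⁻ g dF ω) dQ < c`.
[folklore: measure theory] -/
theorem frequently_le_lintegral_of_bind [IsProbabilityMeasure Q] (hF : Measurable F) {g : α → ℝ≥0∞} (hg : Measurable g) {c : ℝ≥0∞}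
    (hfin : ∫⁻ a, g a ∂(Q.bind F) ≠ ∞) (hc : c ≤ ∫⁻ a, g a ∂(Q.bind F)) : ∃ᵐ ω ∂Q, c ≤ ∫⁻ a, g a ∂(F ω) := by
  by_contra hnot
  have hlt : ∀ᵐ ω ∂Q, ∫⁻ a, g a ∂(F ω) < c := by
    simpa only [Filter.not_frequently, not_le] using hnot
  have hbind : ∫⁻ a, g a ∂(Q.bind F) = ∫⁻ ω, ∫⁻ a, g a ∂(F ω) ∂Q := Measure.lintegral_bind hF.aemeasurable hg.aemeasurable
  have h : ∫⁻ ω, ∫⁻ a, g a ∂(F ω) ∂Q < ∫⁻ _ω, c ∂Q :=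
    lintegral_strict_mono (IsProbabilityMeasure.ne_zero Q) aemeasurable_const (by rw [← hbind]; exact hfin) hlt
  rw [lintegral_const, measure_univ, mul_one, ← hbind] at h
  exact absurd hc (not_le.2 h)

/-- ★ **UPPER HALF-LINES ARE DETECTED.**  If `P = Q.bind F` gives a measurable `g ≥ 0` an integral `< c`, then `∫⁻ g d(F ω) < c` for a non-null set of
indices `ω`: otherwise `c ≤ ∫⁻ g d(F ω)` almost everywhere and `c = ∫ c dQ ≤ ∫⁻ g dP`. [folklore: measure theory] -/
theorem frequently_lintegral_lt_of_bind [IsProbabilityMeasure Q] (hF : Measurable F) {g : α → ℝ≥0∞} (hg : Measurable g) {c : ℝ≥0∞}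
    (hc : ∫⁻ a, g a ∂(Q.bind F) < c) : ∃ᵐ ω ∂Q, ∫⁻ a, g a ∂(F ω) < c := by
  by_contra hnot
  have hle : ∀ᵐ ω ∂Q, c ≤ ∫⁻ a, g a ∂(F ω) := by
    simpa only [Filter.not_frequently, not_lt] using hnot
  have hbind : ∫⁻ a, g a ∂(Q.bind F) = ∫⁻ ω, ∫⁻ a, g a ∂(F ω) ∂Q := Measure.lintegral_bind hF.aemeasurable hg.aemeasurable
  have h : ∫⁻ _ω, c ∂Q ≤ ∫⁻ ω, ∫⁻ a, g a ∂(F ω) ∂Q := lintegral_mono_ae hle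
  rw [lintegral_const, measure_univ, mul_one, ← hbind] at h
  exact absurd hc (not_lt.2 h)

/-- mass form, lower half-line (`g = 1_U`): `c ≤ P U < ∞` ⟹ `c ≤ F ω U` frequently. [folklore: measure theory] -/
theorem frequently_le_measure_of_bind [IsProbabilityMeasure Q] (hF : Measurable F) {U : Set α} (hU : MeasurableSet U) {c : ℝ≥0∞}
    (hfin : Q.bind F U ≠ ∞) (hc : c ≤ Q.bind F U) : ∃ᵐ ω ∂Q, c ≤ F ω U := by
  have key := frequently_le_lintegral_of_bind hF (g := U.indicator 1) (measurable_one.indicator hU) (c := c)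
    (by rwa [lintegral_indicator_one hU]) (by rwa [lintegral_indicator_one hU])
  exact key.mono fun ω hω => by rwa [lintegral_indicator_one hU] at hω

/-- mass form, upper half-line: `P U < c` ⟹ `F ω U < c` frequently. [folklore: measure theory] -/
theorem frequently_measure_lt_of_bind [IsProbabilityMeasure Q] (hF : Measurable F) {U : Set α} (hU : MeasurableSet U) {c : ℝ≥0∞}
    (hc : Q.bind F U < c) : ∃ᵐ ω ∂Q, F ω U < c := by
  have key := frequently_lintegral_lt_of_bind hF (g := U.indicator 1) (measurable_one.indicator hU) (c := c)
    (by rwa [lintegral_indicator_one hU])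
  exact key.mono fun ω hω => by rwa [lintegral_indicator_one hU] at hω

/-- real mass form, lower half-line: `η ≤ P.real U` (with `P U < ∞` and almost all components finite) ⟹ `η ≤ (F ω).real U` frequently.
[folklore: measure theory] -/
theorem frequently_le_measureReal_of_bind [IsProbabilityMeasure Q] (hF : Measurable F) (hfinF : ∀ᵐ ω ∂Q, IsFiniteMeasure (F ω))
    {U : Set α} (hU : MeasurableSet U) (hfin : Q.bind F U ≠ ∞) {η : ℝ} (hη : η ≤ (Q.bind F).real U) :
    ∃ᵐ ω ∂Q, η ≤ (F ω).real U := by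
  have h1 : ENNReal.ofReal η ≤ Q.bind F U := by
    rw [ENNReal.ofReal_le_iff_le_toReal hfin, ← measureReal_def]
    exact hη
  refine ((frequently_le_measure_of_bind hF hU hfin h1).and_eventually hfinF).mono fun ω hω => ?_
  obtain ⟨hω, hfinω⟩ := hω
  haveI := hfinω
  rw [measureReal_def]
  exact (ENNReal.ofReal_le_iff_le_toReal (measure_ne_top (F ω) U)).1 hω

/-- real mass form, upper half-line: `P.real U < η` (with `P U < ∞`) ⟹ `(F ω).real U < η` frequently. [folklore: measure theory] -/
theorem frequently_measureReal_lt_of_bind [IsProbabilityMeasure Q] (hF : Measurable F) {U : Set α} (hU : MeasurableSet U)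
    (hfin : Q.bind F U ≠ ∞) {η : ℝ} (hη : (Q.bind F).real U < η) : ∃ᵐ ω ∂Q, (F ω).real U < η := by
  have h1 : Q.bind F U < ENNReal.ofReal η := by
    rw [ENNReal.lt_ofReal_iff_toReal_lt hfin, ← measureReal_def]
    exact hη
  exact (frequently_measure_lt_of_bind hF hU h1).mono fun ω hω => by
    rw [measureReal_def]
    exact ENNReal.toReal_lt_of_lt_ofReal hω

end Detect

/-! ## §2. Transfer along a kernel decomposition — almost-everywhere form -/

/-- ★ **ALMOST EVERY COMPONENT IS ADMISSIBLE AND MINIMISING.**  Let `P` be a probability law on configurations of `ℝ³`, almost surely rooted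
`δ`-hard-core, with two almost-sure clauses `p₁`, `p₂`, a null event `S₃` and mean root energy `≤ e⋆`, and let `P = Q.bind F` by a measurable kernel `F`
on any index space whose values are `Q`-almost surely point-stationary probability laws with a property `𝓔`.  Then for `Q`-ALMOST EVERY `ω` the law
`F ω` is a probability law, almost surely rooted `δ`-hard-core, point-stationary, with `𝓔`, with `p₁`, `p₂` almost surely, with `F ω S₃ = 0` AND with mean
root energy `≤ e⋆`: the null sets pass to almost every component (`ae_ae_of_ae_bind`); every point-stationary hard-core component has mean `≥ e⋆`
(item 9229, PROVED: `unimodularEnergyLowerBound_proof`) while the components' means average to the mean of `P` (`Measure.lintegral_bind` on the tree's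
clamped measurable root energy `exists_measurable_bounded_rootEnergy`), so almost every component has mean `≤ e⋆`.  (The a.e. form of the tree's
`…ErgodicTransfer.exists_of_bind`, same argument.) [folklore: ergodic decomposition] -/
theorem ae_admissible_of_bind {δ : ℝ} (hδ : 0 < δ)
    {P : Measure (Measure (EuclideanSpace ℝ (Fin 3)))} [IsProbabilityMeasure P]
    (hcore : ∀ᵐ μ ∂P, IsRootedHardCore δ μ) {p₁ p₂ : Measure (EuclideanSpace ℝ (Fin 3)) → Prop}
    (h₁ : ∀ᵐ μ ∂P, p₁ μ) (h₂ : ∀ᵐ μ ∂P, p₂ μ) {S₃ : Set (Measure (EuclideanSpace ℝ (Fin 3)))}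
    (h₃ : P S₃ = 0)
    (hen : ∫ μ, rootEnergy lennardJones μ ∂P ≤
      ⨅ Q : PeriodicConfiguration 3, Q.energyPerParticle lennardJones)
    {Ω : Type*} [MeasurableSpace Ω] {Q : Measure Ω} [IsProbabilityMeasure Q]
    {F : Ω → Measure (Measure (EuclideanSpace ℝ (Fin 3)))} (hF : Measurable F) (hbind : Q.bind F = P)
    {𝓔 : Measure (Measure (EuclideanSpace ℝ (Fin 3))) → Prop}
    (hcomp : ∀ᵐ ω ∂Q, IsProbabilityMeasure (F ω) ∧ IsPointStationaryLaw (F ω) ∧ 𝓔 (F ω)) :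
    ∀ᵐ ω ∂Q, IsProbabilityMeasure (F ω) ∧ (∀ᵐ μ ∂F ω, IsRootedHardCore δ μ) ∧ IsPointStationaryLaw (F ω) ∧ 𝓔 (F ω) ∧
      (∀ᵐ μ ∂F ω, p₁ μ) ∧ (∀ᵐ μ ∂F ω, p₂ μ) ∧ F ω S₃ = 0 ∧
      ∫ μ, rootEnergy lennardJones μ ∂F ω ≤
        ⨅ Q : PeriodicConfiguration 3, Q.energyPerParticle lennardJones := by
  have hLB := Summit.AtomisticToContinuum.Crystallization.Theorems.unimodularEnergyLowerBound_proof
  set e : ℝ := ⨅ Q : PeriodicConfiguration 3, Q.energyPerParticle lennardJones with he_def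
  -- null sets and almost-sure properties pass to almost every component
  have hcore' : ∀ᵐ ω ∂Q, ∀ᵐ μ ∂F ω, IsRootedHardCore δ μ :=
    ae_ae_of_ae_bind hF (by rw [hbind]; exact hcore)
  have h₁' : ∀ᵐ ω ∂Q, ∀ᵐ μ ∂F ω, p₁ μ := ae_ae_of_ae_bind hF (by rw [hbind]; exact h₁)
  have h₂' : ∀ᵐ ω ∂Q, ∀ᵐ μ ∂F ω, p₂ μ := ae_ae_of_ae_bind hF (by rw [hbind]; exact h₂)
  have h₃' : ∀ᵐ ω ∂Q, F ω S₃ = 0 := by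
    have h : ∀ᵐ μ ∂Q.bind F, μ ∉ S₃ := by rw [hbind]; exact compl_mem_ae_iff.2 h₃
    exact (ae_ae_of_ae_bind hF h).mono fun ω hω => compl_mem_ae_iff.1 hω
  -- the clamped measurable root energy and its nonnegative shift
  obtain ⟨B, hB0, G, hG, hGB, hGeq⟩ := exists_measurable_bounded_rootEnergy hδ
  set f : Measure (EuclideanSpace ℝ (Fin 3)) → ℝ≥0∞ := fun μ => ENNReal.ofReal (G μ + B) with hf_def
  have hf : Measurable f := ENNReal.measurable_ofReal.comp (hG.add_const B)
  set L : Measure (Measure (EuclideanSpace ℝ (Fin 3))) → ℝ≥0∞ := fun P' => ∫⁻ μ, f μ ∂P' with hL_def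
  have hL : Measurable L := Measure.measurable_lintegral hf
  have hmean : ∀ (P' : Measure (Measure (EuclideanSpace ℝ (Fin 3)))), IsProbabilityMeasure P' →
      (∀ᵐ μ ∂P', IsRootedHardCore δ μ) →
      ∫ μ, rootEnergy lennardJones μ ∂P' = (L P').toReal - B := by
    intro P' hP' hcP'
    rw [← integral_eq_toReal_lintegral_sub hG hGB]
    exact integral_congr_ae (hcP'.mono fun μ hμ => (hGeq μ hμ).symm)
  have hLfin : ∀ (P' : Measure (Measure (EuclideanSpace ℝ (Fin 3)))), IsProbabilityMeasure P' →
      L P' ≠ ∞ := fun P' hP' =>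
    ((lintegral_ofReal_add_le (Q := P') hGB).trans_lt ENNReal.ofReal_lt_top).ne
  have hPmean : ∫ μ, rootEnergy lennardJones μ ∂P = (L P).toReal - B := hmean P inferInstance hcore
  have heB : 0 ≤ e + B := by
    by_contra hlt
    have hlt' : e + B < 0 := lt_of_not_ge hlt
    have h0 : 0 ≤ (L P).toReal := ENNReal.toReal_nonneg
    rw [hPmean] at hen
    linarith
  -- lower bound on almost every component (item 9229)
  have hlow : ∀ᵐ ω ∂Q, ENNReal.ofReal (e + B) ≤ L (F ω) := by
    filter_upwards [hcomp, hcore'] with ω hω hcω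
    obtain ⟨hprob, hstat, -⟩ := hω
    have hlb : e ≤ ∫ μ, rootEnergy lennardJones μ ∂F ω := hLB δ hδ (F ω) hprob hcω hstat
    rw [hmean (F ω) hprob hcω] at hlb
    rw [ENNReal.ofReal_le_iff_le_toReal (hLfin (F ω) hprob)]
    linarith
  -- upper bound `∫ L (F ω) dQ = L P ≤ e + B`
  have hLP : L P = ∫⁻ ω, L (F ω) ∂Q := by
    simp only [hL_def]
    rw [← hbind]
    exact Measure.lintegral_bind hF.aemeasurable hf.aemeasurable
  have hup : ∫⁻ ω, L (F ω) ∂Q ≤ ENNReal.ofReal (e + B) := by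
    rw [← hLP, ENNReal.le_ofReal_iff_toReal_le (hLfin P inferInstance) heB]
    rw [hPmean] at hen
    linarith
  have hle : ∀ᵐ ω ∂Q, L (F ω) ≤ ENNReal.ofReal (e + B) := by
    have hmeasL : Measurable fun ω => L (F ω) := hL.comp hF
    have hsub : ∫⁻ ω, (L (F ω) - ENNReal.ofReal (e + B)) ∂Q = 0 := by
      rw [lintegral_sub measurable_const (by simp) hlow, lintegral_const, measure_univ, mul_one]
      exact tsub_eq_zero_of_le hup
    have hmeas : Measurable fun ω => L (F ω) - ENNReal.ofReal (e + B) := hmeasL.sub measurable_const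
    rw [lintegral_eq_zero_iff hmeas] at hsub
    filter_upwards [hsub] with ω hω
    simpa only [Pi.zero_apply, tsub_eq_zero_iff_le] using hω
  -- almost every index is good
  filter_upwards [hcomp, hcore', h₁', h₂', h₃', hle] with ω hω hcω h1ω h2ω h3ω hleω
  obtain ⟨hprob, hstat, hE⟩ := hω
  refine ⟨hprob, hcω, hstat, hE, h1ω, h2ω, h3ω, ?_⟩
  rw [hmean (F ω) hprob hcω]
  have h := ENNReal.toReal_mono ENNReal.ofReal_ne_top hleω
  rw [ENNReal.toReal_ofReal heB] at h
  linarith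

/-! ## §3. ★★ Regimes detected by mixtures reduce to ERGODIC laws -/

/-- ★★ **ERGODIC REDUCTION OF A REGIME.**  Let `X` be a regime of laws that kernel mixtures DETECT (`hdet`: whenever a probability law `P` carried
by rooted `7/10`-hard-core configurations is written `P = Q.bind F` for a probability measure `Q` on the configuration space `RootedHardCoreConfig ℝ³
(7/10)` and a measurable kernel `F` with almost surely probability values, `X P` forces `X (F ω)` for a non-null set of `ω` — §1 discharges this for
every half-line regime).  If no ERGODIC admissible minimising law lies in `X` (the regime `X ∧ «every measurable re-rooting-invariant set is trivial»`,
the ergodicity clause of the registered residual `S_aperiodicErgodicGap` verbatim), then no admissible minimising law lies in `X`: decompose such a law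
by the tree's PROVED kernel ergodic decomposition (`kernelDecomposition_of_aeErgodic aeErgodic_condExpKernel_hErg`), take a component that is admissible,
minimising and ergodic (§2: almost every one) and in `X` (`hdet`: a non-null set of them). [new: junction] -/
theorem noAdmissibleMinimiserWith_of_ergodic {X : Measure (Measure E3) → Prop}
    (hdet : ∀ P : Measure (Measure E3), IsProbabilityMeasure P → (∀ᵐ μ ∂P, IsRootedHardCore (7 / 10) μ) →
      ∀ Q : Measure (RootedHardCoreConfig E3 (7 / 10)), IsProbabilityMeasure Q →
      ∀ F : RootedHardCoreConfig E3 (7 / 10) → Measure (Measure E3), Measurable F → Q.bind F = P →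
      (∀ᵐ ω ∂Q, IsProbabilityMeasure (F ω)) → X P → ∃ᵐ ω ∂Q, X (F ω))
    (h : NoAdmissibleMinimiserWith fun P => X P ∧ ∀ A : Set (Measure E3), MeasurableSet A →
      (∀ μ : Measure E3, ∀ p : E3, μ {p} ≠ 0 → (μ ∈ A ↔ Measure.map (fun z : E3 => z - p) μ ∈ A)) → P A = 0 ∨ P Aᶜ = 0) :
    NoAdmissibleMinimiserWith X := by
  intro P
  dsimp only
  intro hP ha hb hd he h0 hmin hX
  haveI := hP
  obtain ⟨R₇, R₈, R₉, hd'⟩ := hd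
  obtain ⟨Q, hQ, F, hF, hbind, hcomp⟩ :=
    kernelDecomposition_of_aeErgodic aeErgodic_condExpKernel_hErg (7 / 10) (by norm_num) P hP ha hb
  haveI := hQ
  have hae := ae_admissible_of_bind (by norm_num : (0 : ℝ) < 7 / 10) ha hd' he h0 hmin hF hbind
    (𝓔 := fun P' : Measure (Measure E3) => ∀ A : Set (Measure E3), MeasurableSet A →
      (∀ μ : Measure E3, ∀ p : E3, μ {p} ≠ 0 → (μ ∈ A ↔ Measure.map (fun z : E3 => z - p) μ ∈ A)) → P' A = 0 ∨ P' Aᶜ = 0)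
    hcomp
  have hfreq : ∃ᵐ ω ∂Q, X (F ω) := hdet P hP ha Q hQ F hF hbind (hcomp.mono fun ω hω => hω.1) hX
  obtain ⟨ω, hXω, hprob, hcω, hstat, herg, h1, h2, h3, henω⟩ := (hfreq.and_eventually hae).exists
  have hω := h (F ω)
  dsimp only at hω
  exact hω hprob hcω hstat ⟨R₇, R₈, R₉, h1⟩ h2 h3 henω ⟨hXω, herg⟩

/-! ## §4. Specialisations by name: the mass regimes, the ergodic cut, the residual of record -/

/-- ★ **A(η) REDUCES TO ERGODIC LAWS.**  The residual of the mass split, `OffAtlasMassGap n K η` («no admissible minimising law puts mass `≥ η` off the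
rows»), follows from its ERGODIC restriction: no ERGODIC admissible minimising law puts mass `≥ η` off the rows (lower half-line regime, detected by
`frequently_le_measureReal_of_bind`). [new: junction] -/
theorem offAtlasMassGap_of_ergodic (n : ℕ) (K : ℕ → Set (Measure E3)) (hK : ∀ i, MeasurableSet (K i)) (η : ℝ)
    (h : NoAdmissibleMinimiserWith fun P => η ≤ P.real (⋃ i ∈ Finset.range n, K i)ᶜ ∧ ∀ A : Set (Measure E3), MeasurableSet A →
      (∀ μ : Measure E3, ∀ p : E3, μ {p} ≠ 0 → (μ ∈ A ↔ Measure.map (fun z : E3 => z - p) μ ∈ A)) → P A = 0 ∨ P Aᶜ = 0) :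
    OffAtlasMassGap n K η := by
  refine noAdmissibleMinimiserWith_of_ergodic (fun P hP _ Q hQ F hF hbind hfinF hX => ?_) h
  haveI := hP
  haveI := hQ
  have hU : MeasurableSet (⋃ i ∈ Finset.range n, K i)ᶜ := (Finset.measurableSet_biUnion _ fun j _ => hK j).compl
  have hfin : Q.bind F (⋃ i ∈ Finset.range n, K i)ᶜ ≠ ∞ := by rw [hbind]; exact measure_ne_top P _
  have hX' : η ≤ (Q.bind F).real (⋃ i ∈ Finset.range n, K i)ᶜ := by rw [hbind]; exact hX
  exact frequently_le_measureReal_of_bind hF (hfinF.mono fun ω hω => by haveI := hω; infer_instance) hU hfin hX'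

/-- ★ **F(η) REDUCES TO ERGODIC LAWS.**  `CoherentMassExclusion n K η` («no admissible minimising law puts mass `< η` off the rows») follows from its
ERGODIC restriction (upper half-line regime, detected by `frequently_measureReal_lt_of_bind`). [new: junction] -/
theorem coherentMassExclusion_of_ergodic (n : ℕ) (K : ℕ → Set (Measure E3)) (hK : ∀ i, MeasurableSet (K i)) (η : ℝ)
    (h : NoAdmissibleMinimiserWith fun P => P.real (⋃ i ∈ Finset.range n, K i)ᶜ < η ∧ ∀ A : Set (Measure E3), MeasurableSet A →
      (∀ μ : Measure E3, ∀ p : E3, μ {p} ≠ 0 → (μ ∈ A ↔ Measure.map (fun z : E3 => z - p) μ ∈ A)) → P A = 0 ∨ P Aᶜ = 0) :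
    CoherentMassExclusion n K η := by
  refine noAdmissibleMinimiserWith_of_ergodic (fun P hP _ Q hQ F hF hbind _ hX => ?_) h
  haveI := hP
  haveI := hQ
  have hU : MeasurableSet (⋃ i ∈ Finset.range n, K i)ᶜ := (Finset.measurableSet_biUnion _ fun j _ => hK j).compl
  have hfin : Q.bind F (⋃ i ∈ Finset.range n, K i)ᶜ ≠ ∞ := by rw [hbind]; exact measure_ne_top P _
  have hX' : (Q.bind F).real (⋃ i ∈ Finset.range n, K i)ᶜ < η := by rw [hbind]; exact hX
  exact frequently_measureReal_lt_of_bind hF hU hfin hX'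

/-- THE ERGODIC CUT AS THE DEGENERATE INSTANCE `X = True`: no ERGODIC admissible minimising law ⟹ no admissible minimising law (the content of the tree's
`…ErgodicCut.aperiodicFrustratedLawGap_iff_ergodicCase`, in the regime vocabulary of (404)). [new: junction] -/
theorem noAdmissibleMinimiser_of_ergodic
    (h : NoAdmissibleMinimiserWith fun P => True ∧ ∀ A : Set (Measure E3), MeasurableSet A →
      (∀ μ : Measure E3, ∀ p : E3, μ {p} ≠ 0 → (μ ∈ A ↔ Measure.map (fun z : E3 => z - p) μ ∈ A)) → P A = 0 ∨ P Aᶜ = 0) :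
    NoAdmissibleMinimiserWith fun _ => True :=
  noAdmissibleMinimiserWith_of_ergodic (fun _ _ _ Q hQ _ _ _ _ _ => by
    haveI := hQ
    exact Filter.Eventually.frequently (Filter.Eventually.of_forall fun _ => trivial)) h

/-- ★ **THE MASS SPLIT WITH AN ERGODIC RESIDUAL CLOSES THE CRUX**: F(η) and the ERGODIC restriction of A(η) prove `AperiodicFrustratedLawGap` (route decl,
by name; (404) `aperiodicFrustratedLawGap_of_massSplit` after `offAtlasMassGap_of_ergodic`). [new: junction] -/
theorem aperiodicFrustratedLawGap_of_massSplit_ergodic (n : ℕ) (K : ℕ → Set (Measure E3)) (hK : ∀ i, MeasurableSet (K i)) (η : ℝ)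
    (hF : CoherentMassExclusion n K η)
    (hA : NoAdmissibleMinimiserWith fun P => η ≤ P.real (⋃ i ∈ Finset.range n, K i)ᶜ ∧ ∀ A : Set (Measure E3), MeasurableSet A →
      (∀ μ : Measure E3, ∀ p : E3, μ {p} ≠ 0 → (μ ∈ A ↔ Measure.map (fun z : E3 => z - p) μ ∈ A)) → P A = 0 ∨ P Aᶜ = 0) :
    Summit.AtomisticToContinuum.Crystallization.Theses.FrustratedLawDichotomy.AperiodicFrustratedLawGap :=
  Summit.AtomisticToContinuum.Crystallization.Theorems.FrustratedLawDichotomyAtlasReach.aperiodicFrustratedLawGap_of_massSplit n K η hF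
    (offAtlasMassGap_of_ergodic n K hK η hA)

/-- ★★ **THE RESIDUAL OF RECORD, MADE ERGODIC.**  The crux `AperiodicFrustratedLawGap` follows from: «no ERGODIC admissible minimising law (clauses
(a)(b)(d)(e), aperiodic, `E[rootEnergy] ≤ e⋆`, every measurable re-rooting-invariant set trivial) gives the complement of the certified F1 row `KF1c` mass
`≥ reach (23/10⁴) 5`» — the F side being F1Sharp's UNCONDITIONAL `coherentMassExclusion_F1_sharp`.  Compared with F1Sharp's
`aperiodicFrustratedLawGap_of_offAtlasMassGap_F1_sharp`, the next cut may now assume its law ergodic. [new: junction instance] -/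
theorem aperiodicFrustratedLawGap_of_ergodicOffAtlasMassGap_F1_sharp
    (hA : NoAdmissibleMinimiserWith fun P => reach (23 / 10000) 5 ≤ P.real (⋃ i ∈ Finset.range 1, (fun _ : ℕ => KF1c) i)ᶜ ∧
      ∀ A : Set (Measure E3), MeasurableSet A →
      (∀ μ : Measure E3, ∀ p : E3, μ {p} ≠ 0 → (μ ∈ A ↔ Measure.map (fun z : E3 => z - p) μ ∈ A)) → P A = 0 ∨ P Aᶜ = 0) :
    Summit.AtomisticToContinuum.Crystallization.Theses.FrustratedLawDichotomy.AperiodicFrustratedLawGap :=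
  aperiodicFrustratedLawGap_of_massSplit_ergodic 1 (fun _ => KF1c) (fun _ => measurableSet_KF1c) _ coherentMassExclusion_F1_sharp hA

end Summit.AtomisticToContinuum.Crystallization.Theorems.FrustratedLawDichotomyAtlasReachErgodic

end
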